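import Mathlib
import Summits.NavierStokesRegularity.NavierStokesRegularity.Theorems.EulerZoomLiouvillePowerGaugeEulerLiouvilleDSSEndpointMemberAnyFactor
import HarnessLib

/-!
# Rung C2 of the crux `EulerZoomLiouville.PowerGaugeEulerLiouville` at the endpoint `ρ = 1/2` (weak class):
# the SHELL-SPREAD widening of the DSS power-spread stratum

Route №10 `EulerZoomLiouville` (NavierStokesRegularity), crux E = stmt-NavierStokesRegularity-19832,
registered open stub `stub_nonSelfSimilarRest`; its binder `¬ (ρ = 1/2 ∧ IsDSSPowerSpread ρ u p)`
records the filled DSS endpoint stratum (`dss_half_ae_eq_zero_of_powerSpread'`: Chae–Shvydkoy's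
Thm 3.1 for DISCRETELY self-similar members, any factor `l > 1`, with the POINTWISE two-sided spread
`c₀|y|^{−(4−δ')} ≤ |u(τ,y)| ≤ C_up|y|^{1−δ}` a.e. far out on a.e. slice of one period).  As for the
exactly self-similar members (`…SelfSimilarEndpointShellSpread`), the tree's proof uses the lower
POINTWISE bound only at the very end, against the period-energy drain
`∫_{period} ∫_{L≤|y|<2L} |u(τ)|² ≤ C_ε L^{−5+ε}` (`dss_half_periodEnergy_decay`).  This file replaces it
by a lower bound on the PERIOD-INTEGRATED DYADIC SHELL ENERGIES along radii beyond every bound: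

* `DSSEndpointSpread.dss_half_period_false_of_shellLower` — period level (factor `l ≥ 4`, the
  hypotheses of `dss_half_periodEnergy_decay` + `c₀ L^{−5+η} ≤ ∫_{(l^{5/2}τ₀, τ₀)}∫_{L≤|y|<2L}|u(τ)|²`
  for some `c₀, η > 0` and radii `L` beyond every bound) ⇒ contradiction;
* `DSSEndpointSpread.dss_half_false_of_shellLower` — member level, factor `l ≥ 4`: crux hypotheses
  verbatim at `ρ = 1/2`, DSS, sublinear slices on the period, the shell lower bound ⇒ `False`;
* `DSSEndpointSpread.dss_half_false_of_shellLower'` / `…ae_eq_zero_of_shellLower'` — ANY factor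
  `l > 1`: the member is DSS with factor `l^k ≥ 4` (`dss_iterate`); the sublinear bound is transported
  to the `k` periods (`dss_half_transport_upper`, `ae_window_of_periods`), and the shell lower bound on
  the ONE period `(l^{5/2}τ₀, τ₀)` bounds the `l^k`-period integral from below (nonnegative integrand,
  `period_sliceSetEnergy`);
* `DSSEndpointSpread.period_shellLower_of_powerLower` — the pointwise power-spread lower bound on a.e.
  slice of the period implies the period-integrated shell bound (`shell_energy_lower_of_powerLower`),
  so the tree's stratum is the special case.

WHAT THIS IS NOT: not NS, not E, not the stub — a widening of one filled endpoint stratum; the DSS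
endpoint without any lower bound stays open. [cite: ChaeShvydkoy2013, §3.1 Thm. 3.1; Xue2014DSSEuler, Thm 1.1 (ii)]
-/

noncomputable section

-- flat `Theorems/<Route><Decl>…` files of one crux share the namespace of the crux (tree convention)
set_option linter.dupNamespace false

open MeasureTheory Set Filter Topology Metric Function TopologicalSpace
open scoped ENNReal NNReal InnerProductSpace RealInnerProductSpace

namespace Summit.NavierStokesRegularity.NavierStokesRegularity.Theorems.PowerGaugeEulerLiouville

open Literature.Analysis Literature.Analysis.FunctionSpaces Literature.Analysis.FluidPDE

namespace DSSEndpointSpread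

variable {u : ℝ → EuclideanSpace ℝ (Fin 3) → EuclideanSpace ℝ (Fin 3)}
  {p : ℝ → EuclideanSpace ℝ (Fin 3) → ℝ}
  {H : ℝ → EuclideanSpace ℝ (Fin 3) → EuclideanSpace ℝ (Fin 3) →L[ℝ] EuclideanSpace ℝ (Fin 3)}
  {c : ℝ≥0}

/-- **No DSS member with sublinear slices whose period-integrated shell energies are frequently
`≥ c₀ L^{−5+η}` (period form, factor `l ≥ 4`).**  Under the hypotheses of `dss_half_periodEnergy_decay`
and, for some `c₀, η > 0` and radii `L` beyond every bound,
`c₀ L^{−5+η} ≤ ∫_{(l^{5/2}τ₀, τ₀)} ∫_{L≤|y|<2L} |u(τ, y)|² dy dτ`: contradiction with the drain at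
`ε = η/2`. [cite: ChaeShvydkoy2013, §3.1 Thm. 3.1] -/
theorem dss_half_period_false_of_shellLower
    (hsw : IsSuitableWeakSolutionOn (slab (EuclideanSpace ℝ (Fin 3)) (Iio 0) isOpen_Iio) 0 0 u p)
    {l : ℝ} (hl : 4 ≤ l)
    (hu : ∀ τ : ℝ, τ < 0 → ∀ y, u τ y = (l ^ (3 / 2 : ℝ)) • u (l ^ (5 / 2 : ℝ) * τ) (l • y))
    (hp : ∀ τ : ℝ, τ < 0 → ∀ y, p τ y = l ^ 3 * p (l ^ (5 / 2 : ℝ) * τ) (l • y))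
    {τ₀ : ℝ} (hτ₀ : τ₀ < 0) {E₀ : ℝ}
    (hE : ∀ᵐ τ : ℝ, τ < 0 → Integrable (fun y => ‖u τ y‖ ^ 2) volume ∧ ∫ y, ‖u τ y‖ ^ 2 ≤ E₀)
    (h3 : ∀ᵐ τ : ℝ, τ < 0 → LocallyIntegrable (fun y => ‖u τ y‖ ^ 3) volume)
    (hPV : ∀ᵐ τ : ℝ, τ < 0 → LocallyIntegrable (fun y => |p τ y| * ‖u τ y‖) volume)
    {δ Cup R₀ : ℝ} (hδ : 0 < δ) (hδ1 : δ ≤ 1) (hCup : 0 ≤ Cup)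
    (hup : ∀ᵐ τ : ℝ, τ ∈ Ioo (l ^ (5 / 2 : ℝ) * τ₀) τ₀ →
      ∀ᵐ y ∂volume, R₀ ≤ ‖y‖ → ‖u τ y‖ ≤ Cup * ‖y‖ ^ (1 - δ))
    {R₁ : ℝ}
    (hPR : ∀ᵐ τ : ℝ, τ ∈ Ioo (l ^ (5 / 2 : ℝ) * τ₀) τ₀ → ∀ R : ℝ, R₁ ≤ R →
      ∀ᵐ y ∂volume, ‖y‖ < R / 2 →
        p τ y = rieszPressure ((ball (0 : EuclideanSpace ℝ (Fin 3)) R).indicator (u τ)) y +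
          ∫ z in {z | R ≤ ‖z‖}, pressureKernel (y - z) (u τ z))
    {c₀ η : ℝ} (hc₀ : 0 < c₀) (hη : 0 < η)
    (hlow : ∀ L₁ : ℝ, ∃ L : ℝ, L₁ ≤ L ∧
      c₀ * L ^ (-(5 : ℝ) + η) ≤
        ∫ τ in Ioo (l ^ (5 / 2 : ℝ) * τ₀) τ₀,
          ∫ y in {y : EuclideanSpace ℝ (Fin 3) | L ≤ ‖y‖ ∧ ‖y‖ < 2 * L}, ‖u τ y‖ ^ 2) : False := by
  -- adapted from `dss_half_period_false_of_powerSpread` / `EndpointSpread.selfSimilar_half_false_of_shellLower`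
  obtain ⟨C, hC⟩ := dss_half_periodEnergy_decay hsw hl hu hp hτ₀ hE h3 hPV hδ hδ1 hCup hup hPR (half_pos hη)
  have hkey : ∀ L : ℝ, 1 ≤ L →
      c₀ * L ^ (-(5 : ℝ) + η) ≤
        ∫ τ in Ioo (l ^ (5 / 2 : ℝ) * τ₀) τ₀,
          ∫ y in {y : EuclideanSpace ℝ (Fin 3) | L ≤ ‖y‖ ∧ ‖y‖ < 2 * L}, ‖u τ y‖ ^ 2 →
      c₀ * L ^ (η / 2) ≤ C := by
    intro L hL1 hL
    have hL0 : 0 < L := one_pos.trans_le hL1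
    have h1 : c₀ * L ^ (-(5 : ℝ) + η) ≤ C * L ^ (-(5 : ℝ) + η / 2) := hL.trans (hC L hL1)
    have h2 := mul_le_mul_of_nonneg_right h1 (Real.rpow_pos_of_pos hL0 (5 - η / 2)).le
    have e1 : c₀ * L ^ (-(5 : ℝ) + η) * L ^ (5 - η / 2) = c₀ * L ^ (η / 2) := by
      rw [mul_assoc, ← Real.rpow_add hL0]; ring_nf
    have e2 : C * L ^ (-(5 : ℝ) + η / 2) * L ^ (5 - η / 2) = C := by
      rw [mul_assoc, ← Real.rpow_add hL0, show -(5 : ℝ) + η / 2 + (5 - η / 2) = 0 by ring,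
        Real.rpow_zero, mul_one]
    rwa [e1, e2] at h2
  have hev : ∀ᶠ L : ℝ in atTop, C / c₀ < L ^ (η / 2) :=
    (tendsto_rpow_atTop (half_pos hη)).eventually_gt_atTop (C / c₀)
  obtain ⟨L₁, hL₁⟩ := (hev.and (eventually_ge_atTop (1 : ℝ))).exists_forall_of_atTop
  obtain ⟨L, hLL₁, hL⟩ := hlow L₁
  have h := hkey L (hL₁ L hLL₁).2 hL
  have h' := (hL₁ L hLL₁).1
  rw [div_lt_iff₀ hc₀] at h'
  linarith [mul_comm c₀ (L ^ (η / 2))]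

/-- **A pointwise lower power bound on a.e. slice of the period gives the period-integrated shell
lower bound** (so the shell-lower stratum contains the power-spread stratum): with the slice energies
`≤ E₀` a.e. and `c₀|y|^{−(4−δ')} ≤ |u(τ,y)|` a.e. on `|y| ≥ R₀'` for a.e. `τ` of the period `(α, β)`
(`β < 0`), `T c₁ L^{−5+2 min(δ',4)} ≤ ∫_{(α,β)}∫_{L≤|y|<2L}|u(τ)|²` for all `L ≥ max R₀' 1`
(`T = β − α`, `c₁ > 0` explicit). [cite: ChaeShvydkoy2013, §3.1 proof of Thm. 3.1] -/
theorem period_shellLower_of_powerLower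
    (hum : AEStronglyMeasurable (uncurry u)
      (volume.restrict (Iio (0 : ℝ) ×ˢ (univ : Set (EuclideanSpace ℝ (Fin 3))))))
    {E₀ : ℝ}
    (hE : ∀ᵐ τ : ℝ, τ < 0 → Integrable (fun y => ‖u τ y‖ ^ 2) volume ∧ ∫ y, ‖u τ y‖ ^ 2 ≤ E₀)
    {α β : ℝ} (hαβ : α ≤ β) (hβ : β < 0)
    {c₀ δ' R₀' : ℝ} (hc₀ : 0 < c₀) (hδ' : 0 < δ')
    (hlow : ∀ᵐ τ : ℝ, τ ∈ Ioo α β → ∀ᵐ y ∂volume, R₀' ≤ ‖y‖ → c₀ * ‖y‖ ^ (-(4 - δ')) ≤ ‖u τ y‖) :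
    ∃ c₁ η : ℝ, 0 < c₁ ∧ 0 < η ∧ ∀ L : ℝ, max R₀' 1 ≤ L →
      (β - α) * c₁ * L ^ (-(5 : ℝ) + η) ≤
        ∫ τ in Ioo α β, ∫ y in {y : EuclideanSpace ℝ (Fin 3) | L ≤ ‖y‖ ∧ ‖y‖ < 2 * L}, ‖u τ y‖ ^ 2 := by
  -- adapted from `dss_half_period_false_of_powerSpread` (the step `hlowf`)
  set δ₀ : ℝ := min δ' 4 with hδ₀
  have hδ₀0 : 0 < δ₀ := lt_min hδ' (by norm_num)
  have hδ₀4 : δ₀ ≤ 4 := min_le_right _ _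
  have hI0 : Ioo α β ⊆ Iio 0 := fun t ht => ht.2.trans hβ
  have hv : 0 < volume.real (ball (0 : EuclideanSpace ℝ (Fin 3)) 1) := by
    rw [measureReal_def]
    exact ENNReal.toReal_pos (measure_ball_pos volume 0 one_pos).ne' measure_ball_lt_top.ne
  set c₁ : ℝ := c₀ ^ 2 * (2 : ℝ) ^ (-(8 - 2 * δ₀)) * (1 / 4) ^ 3 *
    volume.real (ball (0 : EuclideanSpace ℝ (Fin 3)) 1) with hc₁
  have hc₁0 : 0 < c₁ := by positivity
  have hlow' : ∀ᵐ τ : ℝ, τ ∈ Ioo α β → ∀ᵐ y ∂volume, max R₀' 1 ≤ ‖y‖ →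
      c₀ * ‖y‖ ^ (-(4 - δ₀)) ≤ ‖u τ y‖ := by
    filter_upwards [hlow] with τ hτ hτI
    filter_upwards [hτ hτI] with y hy hyR
    have hy1 : 1 ≤ ‖y‖ := (le_max_right _ _).trans hyR
    refine le_trans ?_ (hy ((le_max_left _ _).trans hyR))
    exact mul_le_mul_of_nonneg_left
      (Real.rpow_le_rpow_of_exponent_le hy1 (by linarith [min_le_left δ' 4])) hc₀.le
  refine ⟨c₁, 2 * δ₀, hc₁0, by linarith, fun L hL => ?_⟩
  obtain ⟨hif, -, -⟩ := period_sliceSetEnergy hum hE (α := α) hβ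
    ((measurableSet_le measurable_const measurable_norm).inter
      (measurableSet_lt measurable_norm measurable_const) :
      MeasurableSet {y : EuclideanSpace ℝ (Fin 3) | L ≤ ‖y‖ ∧ ‖y‖ < 2 * L})
  have hpt : ∀ᵐ τ : ℝ, τ ∈ Ioo α β → c₁ * L ^ (-(5 : ℝ) + 2 * δ₀) ≤
      ∫ y in {y : EuclideanSpace ℝ (Fin 3) | L ≤ ‖y‖ ∧ ‖y‖ < 2 * L}, ‖u τ y‖ ^ 2 := by
    filter_upwards [hE, hlow'] with τ hEτ hlτ hτI
    have h := shell_energy_lower_of_powerLower (hEτ (hI0 hτI)).1 hc₀ hδ₀4 (hlτ hτI)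
      (le_of_eq_of_le (by simp) hL)
    simpa [hc₁] using h
  calc (β - α) * c₁ * L ^ (-(5 : ℝ) + 2 * δ₀)
      = ∫ τ in Ioo α β, c₁ * L ^ (-(5 : ℝ) + 2 * δ₀) := by
        rw [setIntegral_const, Real.volume_real_Ioo_of_le hαβ, smul_eq_mul]; ring
    _ ≤ _ := setIntegral_mono_ae_restrict (integrable_const _) hif
        ((ae_restrict_iff' measurableSet_Ioo).2 hpt)

/-- **No DSS member (factor `l ≥ 4`) with sublinear slices and the period shell lower bound, in E's
class at `ρ = 1/2`.**  Crux hypotheses verbatim; `u(τ,y) = l^{1+ρ} u(l^{2+ρ}τ, l y)` (and `p`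
accordingly) for `τ < 0`; on a.e. slice of the period `(l^{5/2}τ₀, τ₀)` the sublinear bound
`|u(τ,y)| ≤ C_up|y|^{1−δ}` a.e. for `|y| ≥ R₀`; and, for some `c₀, η > 0` and radii beyond every bound,
`c₀ L^{−5+η} ≤ ∫_{(l^{5/2}τ₀, τ₀)}∫_{L≤|y|<2L}|u(τ,y)|²`.  Then `False` (the per-slice class inputs
`ae_slice_energy_of_gauge_half`, `ae_slice_cube_locallyIntegrable`,
`ae_slice_pressure_velocity_locallyIntegrable`, `ae_slice_riesz_of_gauge_half` feed
`dss_half_period_false_of_shellLower`). [cite: ChaeShvydkoy2013, §3.1 Thm. 3.1; Xue2014DSSEuler, Thm 1.1 (ii)] -/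
theorem dss_half_false_of_shellLower {ρ : ℝ} (hρ : ρ = 1 / 2)
    (hsw : IsSuitableWeakSolutionOn (slab (EuclideanSpace ℝ (Fin 3)) (Iio 0) isOpen_Iio) 0 0 u p)
    (hH : HasWeakSpatialGradientOn (slab (EuclideanSpace ℝ (Fin 3)) (Iio 0) isOpen_Iio) u H)
    (hgauge : ∀ a : ℝ, 0 < a →
      ENNReal.ofReal (a ^ (2 * ρ)) * cknA a (0 : ℝ × EuclideanSpace ℝ (Fin 3)) u +
          ENNReal.ofReal (a ^ ρ) * cknE a (0 : ℝ × EuclideanSpace ℝ (Fin 3)) H +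
        ENNReal.ofReal (a ^ (2 * ρ)) * cknD a (0 : ℝ × EuclideanSpace ℝ (Fin 3)) p ≤ (c : ℝ≥0∞))
    {l : ℝ} (hl : 4 ≤ l)
    (hu : ∀ τ : ℝ, τ < 0 → ∀ y, u τ y = (l ^ (1 + ρ)) • u ((l ^ (2 + ρ)) * τ) (l • y))
    (hp : ∀ τ : ℝ, τ < 0 → ∀ y, p τ y = (l ^ (2 * (1 + ρ))) * p ((l ^ (2 + ρ)) * τ) (l • y))
    {τ₀ : ℝ} (hτ₀ : τ₀ < 0)
    {δ Cup R₀ : ℝ} (hδ : 0 < δ) (hδ1 : δ ≤ 1) (hCup : 0 ≤ Cup)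
    (hup : ∀ᵐ τ : ℝ, τ ∈ Ioo ((l ^ (2 + ρ)) * τ₀) τ₀ →
      ∀ᵐ y ∂volume, R₀ ≤ ‖y‖ → ‖u τ y‖ ≤ Cup * ‖y‖ ^ (1 - δ))
    {c₀ η : ℝ} (hc₀ : 0 < c₀) (hη : 0 < η)
    (hlow : ∀ L₁ : ℝ, ∃ L : ℝ, L₁ ≤ L ∧
      c₀ * L ^ (-(5 : ℝ) + η) ≤
        ∫ τ in Ioo ((l ^ (2 + ρ)) * τ₀) τ₀,
          ∫ y in {y : EuclideanSpace ℝ (Fin 3) | L ≤ ‖y‖ ∧ ‖y‖ < 2 * L}, ‖u τ y‖ ^ 2) : False := by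
  -- adapted from `dss_half_false_of_powerSpread`
  subst hρ
  have hl0 : 0 < l := by linarith
  have hA : ∀ a : ℝ, 0 < a → ENNReal.ofReal (a ^ (2 * (1 / 2 : ℝ))) *
      cknA a (0 : ℝ × EuclideanSpace ℝ (Fin 3)) u ≤ (c : ℝ≥0∞) :=
    fun a ha => le_trans (le_trans le_self_add le_self_add) (hgauge a ha)
  have hD : ∀ a : ℝ, 0 < a → ENNReal.ofReal (a ^ (2 * (1 / 2 : ℝ))) *
      cknD a (0 : ℝ × EuclideanSpace ℝ (Fin 3)) p ≤ (c : ℝ≥0∞) :=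
    fun a ha => le_trans le_add_self (hgauge a ha)
  have e1 : (1 : ℝ) + 1 / 2 = 3 / 2 := by norm_num
  have e2 : (2 : ℝ) + 1 / 2 = 5 / 2 := by norm_num
  have e3 : l ^ (2 * (1 + 1 / 2 : ℝ)) = l ^ 3 := by
    rw [show (2 : ℝ) * (1 + 1 / 2) = (3 : ℕ) by norm_num, Real.rpow_natCast]
  rw [e2] at hup hlow
  have hu' : ∀ τ : ℝ, τ < 0 → ∀ y, u τ y = (l ^ (3 / 2 : ℝ)) • u (l ^ (5 / 2 : ℝ) * τ) (l • y) := by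
    intro τ hτ y; rw [hu τ hτ y, e1, e2]
  have hp' : ∀ τ : ℝ, τ < 0 → ∀ y, p τ y = l ^ 3 * p (l ^ (5 / 2 : ℝ) * τ) (l • y) := by
    intro τ hτ y; rw [hp τ hτ y, e3, e2]
  have hum : AEStronglyMeasurable (uncurry u)
      (volume.restrict (Iio (0 : ℝ) ×ˢ (univ : Set (EuclideanSpace ℝ (Fin 3))))) := by
    have := hH.locallyIntegrableOn.aestronglyMeasurable
    simpa [slab] using this
  have hE := ae_slice_energy_of_gauge_half hum hA
  have h3 := ae_slice_cube_locallyIntegrable hsw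
  have hPV := ae_slice_pressure_velocity_locallyIntegrable hsw
  have hPR := ae_slice_riesz_of_gauge_half hsw hA hD hτ₀ hδ1 (by linarith) hCup hup
  exact dss_half_period_false_of_shellLower hsw hl hu' hp' hτ₀ hE h3 hPV hδ hδ1 hCup hup
    (R₁ := 1) hPR hc₀ hη hlow

/-- **Any factor `l > 1`.**  A DSS member with factor `l > 1` is DSS with factor `l^k ≥ 4`
(`dss_iterate`); the sublinear slice bound is transported to the `k` periods
(`dss_half_transport_upper`, `ae_window_of_periods`); the shell lower bound on the ONE period
`(l^{5/2}τ₀, τ₀)` bounds the integral over the `l^k`-period `((l^k)^{5/2}τ₀, τ₀) ⊇ (l^{5/2}τ₀, τ₀)`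
from below (nonnegative integrand). [cite: ChaeShvydkoy2013, §3.1 Thm. 3.1; Xue2014DSSEuler, Thm 1.1 (ii)] -/
theorem dss_half_false_of_shellLower' {ρ : ℝ} (hρ : ρ = 1 / 2)
    (hsw : IsSuitableWeakSolutionOn (slab (EuclideanSpace ℝ (Fin 3)) (Iio 0) isOpen_Iio) 0 0 u p)
    (hH : HasWeakSpatialGradientOn (slab (EuclideanSpace ℝ (Fin 3)) (Iio 0) isOpen_Iio) u H)
    (hgauge : ∀ a : ℝ, 0 < a →
      ENNReal.ofReal (a ^ (2 * ρ)) * cknA a (0 : ℝ × EuclideanSpace ℝ (Fin 3)) u +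
          ENNReal.ofReal (a ^ ρ) * cknE a (0 : ℝ × EuclideanSpace ℝ (Fin 3)) H +
        ENNReal.ofReal (a ^ (2 * ρ)) * cknD a (0 : ℝ × EuclideanSpace ℝ (Fin 3)) p ≤ (c : ℝ≥0∞))
    {l : ℝ} (hl : 1 < l)
    (hu : ∀ τ : ℝ, τ < 0 → ∀ y, u τ y = (l ^ (1 + ρ)) • u ((l ^ (2 + ρ)) * τ) (l • y))
    (hp : ∀ τ : ℝ, τ < 0 → ∀ y, p τ y = (l ^ (2 * (1 + ρ))) * p ((l ^ (2 + ρ)) * τ) (l • y))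
    {τ₀ : ℝ} (hτ₀ : τ₀ < 0)
    {δ Cup R₀ : ℝ} (hδ : 0 < δ) (hδ1 : δ ≤ 1) (hCup : 0 ≤ Cup)
    (hup : ∀ᵐ τ : ℝ, τ ∈ Ioo ((l ^ (2 + ρ)) * τ₀) τ₀ →
      ∀ᵐ y ∂volume, R₀ ≤ ‖y‖ → ‖u τ y‖ ≤ Cup * ‖y‖ ^ (1 - δ))
    {c₀ η : ℝ} (hc₀ : 0 < c₀) (hη : 0 < η)
    (hlow : ∀ L₁ : ℝ, ∃ L : ℝ, L₁ ≤ L ∧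
      c₀ * L ^ (-(5 : ℝ) + η) ≤
        ∫ τ in Ioo ((l ^ (2 + ρ)) * τ₀) τ₀,
          ∫ y in {y : EuclideanSpace ℝ (Fin 3) | L ≤ ‖y‖ ∧ ‖y‖ < 2 * L}, ‖u τ y‖ ^ 2) : False := by
  -- adapted from `dss_half_false_of_powerSpread'`
  subst hρ
  have hl0 : 0 < l := by linarith
  obtain ⟨k, hk⟩ := pow_unbounded_of_one_lt (4 : ℝ) hl
  have e1 : (1 : ℝ) + 1 / 2 = 3 / 2 := by norm_num
  have e2 : (2 : ℝ) + 1 / 2 = 5 / 2 := by norm_num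
  have hu' : ∀ τ : ℝ, τ < 0 → ∀ y, u τ y = (l ^ (3 / 2 : ℝ)) • u (l ^ (5 / 2 : ℝ) * τ) (l • y) := by
    intro τ hτ y; rw [hu τ hτ y, e1, e2]
  rw [e2] at hup hlow
  have eb : (l ^ k) ^ (2 + 1 / 2 : ℝ) = (l ^ (5 / 2 : ℝ)) ^ k := by
    rw [e2, ← Real.rpow_natCast l k, ← Real.rpow_mul hl0.le, ← Real.rpow_natCast (l ^ (5 / 2 : ℝ)) k,
      ← Real.rpow_mul hl0.le, mul_comm]
  -- the gauges / measurability / slice energies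
  have hA : ∀ a : ℝ, 0 < a → ENNReal.ofReal (a ^ (2 * (1 / 2 : ℝ))) *
      cknA a (0 : ℝ × EuclideanSpace ℝ (Fin 3)) u ≤ (c : ℝ≥0∞) :=
    fun a ha => le_trans (le_trans le_self_add le_self_add) (hgauge a ha)
  have hum : AEStronglyMeasurable (uncurry u)
      (volume.restrict (Iio (0 : ℝ) ×ˢ (univ : Set (EuclideanSpace ℝ (Fin 3))))) := by
    have := hH.locallyIntegrableOn.aestronglyMeasurable
    simpa [slab] using this
  have hE := ae_slice_energy_of_gauge_half hum hA
  -- transport of the sublinear bound to `k` periods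
  have hup0 : ∀ᵐ τ : ℝ, τ ∈ Ioo (l ^ (5 / 2 : ℝ) * τ₀) τ₀ →
      ∀ᵐ y ∂volume, max R₀ 0 ≤ ‖y‖ → ‖u τ y‖ ≤ Cup * ‖y‖ ^ (1 - δ) := by
    filter_upwards [hup] with τ hτ hτI
    filter_upwards [hτ hτI] with y hy hyR
    exact hy ((le_max_left _ _).trans hyR)
  have hupk := fun j => dss_half_transport_upper hl.le hu' hτ₀.le hδ1 hCup hup0 j
  have hupW := ae_window_of_periods hl hτ₀ (le_max_right R₀ 0) (k := k) hupk
  rw [← eb] at hupW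
  -- the shell lower bound on the big window `((l^k)^{5/2} τ₀, τ₀) ⊇ (l^{5/2} τ₀, τ₀)`
  set b : ℝ := l ^ (5 / 2 : ℝ) with hb
  have hb1 : 1 < b := Real.one_lt_rpow hl (by norm_num)
  have hbk : (l ^ k) ^ (2 + 1 / 2 : ℝ) * τ₀ ≤ b * τ₀ := by
    rw [eb]
    have hk1 : 1 ≤ k := by
      by_contra h0
      have : k = 0 := by omega
      rw [this, pow_zero] at hk; linarith
    have hbb : b ≤ b ^ k := le_self_pow₀ hb1.le (by omega)
    nlinarith
  have hlowW : ∀ L₁ : ℝ, ∃ L : ℝ, L₁ ≤ L ∧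
      c₀ * L ^ (-(5 : ℝ) + η) ≤
        ∫ τ in Ioo ((l ^ k) ^ (2 + 1 / 2 : ℝ) * τ₀) τ₀,
          ∫ y in {y : EuclideanSpace ℝ (Fin 3) | L ≤ ‖y‖ ∧ ‖y‖ < 2 * L}, ‖u τ y‖ ^ 2 := by
    intro L₁
    obtain ⟨L, hLL₁, hL⟩ := hlow L₁
    refine ⟨L, hLL₁, hL.trans ?_⟩
    obtain ⟨hif, hnn, -⟩ := period_sliceSetEnergy hum hE (α := (l ^ k) ^ (2 + 1 / 2 : ℝ) * τ₀) hτ₀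
      ((measurableSet_le measurable_const measurable_norm).inter
        (measurableSet_lt measurable_norm measurable_const) :
        MeasurableSet {y : EuclideanSpace ℝ (Fin 3) | L ≤ ‖y‖ ∧ ‖y‖ < 2 * L})
    exact setIntegral_mono_set hif
      ((ae_restrict_iff' measurableSet_Ioo).2 (hnn.mono fun τ hτ hτI => (hτ hτI).1))
      (Ioo_subset_Ioo_left hbk).eventuallyLE
  -- the member is DSS with factor `l^k ≥ 4`
  obtain ⟨huk, hpk⟩ := dss_iterate hl0 hu hp k
  exact dss_half_false_of_shellLower (ρ := 1 / 2) rfl hsw hH hgauge hk.le huk hpk hτ₀ hδ hδ1 hCup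
    hupW hc₀ hη hlowW

/-- **The DSS shell-spread stratum of rung C2 at the endpoint, any factor, `Sig`-shaped**: vacuously
trivial. [cite: ChaeShvydkoy2013, §3.1 Thm. 3.1] -/
theorem dss_half_ae_eq_zero_of_shellLower' {ρ : ℝ} (hρ : ρ = 1 / 2)
    (hsw : IsSuitableWeakSolutionOn (slab (EuclideanSpace ℝ (Fin 3)) (Iio 0) isOpen_Iio) 0 0 u p)
    (hH : HasWeakSpatialGradientOn (slab (EuclideanSpace ℝ (Fin 3)) (Iio 0) isOpen_Iio) u H)
    (hgauge : ∀ a : ℝ, 0 < a →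
      ENNReal.ofReal (a ^ (2 * ρ)) * cknA a (0 : ℝ × EuclideanSpace ℝ (Fin 3)) u +
          ENNReal.ofReal (a ^ ρ) * cknE a (0 : ℝ × EuclideanSpace ℝ (Fin 3)) H +
        ENNReal.ofReal (a ^ (2 * ρ)) * cknD a (0 : ℝ × EuclideanSpace ℝ (Fin 3)) p ≤ (c : ℝ≥0∞))
    {l : ℝ} (hl : 1 < l)
    (hu : ∀ τ : ℝ, τ < 0 → ∀ y, u τ y = (l ^ (1 + ρ)) • u ((l ^ (2 + ρ)) * τ) (l • y))
    (hp : ∀ τ : ℝ, τ < 0 → ∀ y, p τ y = (l ^ (2 * (1 + ρ))) * p ((l ^ (2 + ρ)) * τ) (l • y))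
    {τ₀ : ℝ} (hτ₀ : τ₀ < 0)
    {δ Cup R₀ : ℝ} (hδ : 0 < δ) (hδ1 : δ ≤ 1) (hCup : 0 ≤ Cup)
    (hup : ∀ᵐ τ : ℝ, τ ∈ Ioo ((l ^ (2 + ρ)) * τ₀) τ₀ →
      ∀ᵐ y ∂volume, R₀ ≤ ‖y‖ → ‖u τ y‖ ≤ Cup * ‖y‖ ^ (1 - δ))
    {c₀ η : ℝ} (hc₀ : 0 < c₀) (hη : 0 < η)
    (hlow : ∀ L₁ : ℝ, ∃ L : ℝ, L₁ ≤ L ∧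
      c₀ * L ^ (-(5 : ℝ) + η) ≤
        ∫ τ in Ioo ((l ^ (2 + ρ)) * τ₀) τ₀,
          ∫ y in {y : EuclideanSpace ℝ (Fin 3) | L ≤ ‖y‖ ∧ ‖y‖ < 2 * L}, ‖u τ y‖ ^ 2) :
    uncurry u =ᵐ[volume.restrict (Iio (0 : ℝ) ×ˢ (univ : Set (EuclideanSpace ℝ (Fin 3))))] 0 :=
  (dss_half_false_of_shellLower' hρ hsw hH hgauge hl hu hp hτ₀ hδ hδ1 hCup hup hc₀ hη hlow).elim

end DSSEndpointSpread

end Summit.NavierStokesRegularity.NavierStokesRegularity.Theorems.PowerGaugeEulerLiouville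

end
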